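import Mathlib

/-!
# AtomicCalibrationR (stmt-QuantumFields-28169), E2 `stub_offDiagonalWhitney` — telescoping assembly and the two-factor rate bound
# (construction (T) of the E2 helper note, evidence #19 on 28169; prover w4 g22, free hands)

Two generic pieces of construction (T), stated abstractly so that they apply verbatim to `pairCut` / `gridBump` / `gridBox`
(`AtomicCalibrationRPairCutoff`, `AtomicCalibrationRGridPartition`):

* `norm_iteratedFDeriv_mul_le_add_pow` — **two-factor rate bound**: `‖D^j f‖ ≤ M₁^j`, `‖D^j g‖ ≤ M₂^j` (`j ≤ m`) ⇒
  `‖D^m (f g)‖ ≤ (M₁ + M₂)^m` (Leibniz + binomial theorem); and `norm_iteratedFDeriv_sub_le_pow` — a difference of two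
  `[0,1]`-valued functions with rates `M^j` has rates `(2M)^j`;
* `hasSum_telescope_mul_partition` — **pointwise assembly**: if `χ K z = 1` for `K ≥ k₀` and, for every level `k`, the family
  `c ↦ Φ k c z` vanishes off a finite box and sums to `1` over it, then
  `HasSum (fun p : ℕ × I => a * t p.1 * Φ p.1 p.2 z) a` where `t 0 = χ 0 z`, `t (k+1) = χ (k+1) z − χ k z`;
  `hasSum_telescope_mul_partition_of_eq_zero` — the same sum is `0 = a` when `a = 0` (the coincidence locus, where an
  off-diagonal `F` vanishes).

Mathlib only; no stub/crux/rung/summit is closed; nothing here touches Yang–Mills; the YM mass gap is NOT proved. [folklore]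
-/

set_option autoImplicit false

noncomputable section

open scoped BigOperators ContDiff
open Set Filter

namespace Summit.QuantumFields.YangMills.Cruxes.AtomicCalibrationR.TelescopingAssembly

/-! ## Two-factor rate bound -/

section Rates

variable {E : Type*} [NormedAddCommGroup E] [NormedSpace ℝ E] {A : Type*} [NormedRing A] [NormedAlgebra ℝ A]

/-- **Two-factor rate bound**: geometric derivative bounds multiply by adding the rates. [folklore] -/
theorem norm_iteratedFDeriv_mul_le_add_pow {f g : E → A} (hf : ContDiff ℝ ∞ f) (hg : ContDiff ℝ ∞ g) {M₁ M₂ : ℝ}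
    (hM₁ : 0 ≤ M₁) (m : ℕ) (z : E)
    (hfb : ∀ j : ℕ, j ≤ m → ‖iteratedFDeriv ℝ j f z‖ ≤ M₁ ^ j)
    (hgb : ∀ j : ℕ, j ≤ m → ‖iteratedFDeriv ℝ j g z‖ ≤ M₂ ^ j) :
    ‖iteratedFDeriv ℝ m (fun x => f x * g x) z‖ ≤ (M₁ + M₂) ^ m := by
  have h1 := norm_iteratedFDeriv_mul_le (𝕜 := ℝ) (N := (⊤ : ℕ∞)) hf hg z (n := m) (by exact_mod_cast le_top)
  refine h1.trans ?_
  rw [add_pow]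
  refine Finset.sum_le_sum fun i hi => ?_
  have him : i ≤ m := Nat.lt_succ_iff.1 (Finset.mem_range.1 hi)
  calc (m.choose i : ℝ) * ‖iteratedFDeriv ℝ i f z‖ * ‖iteratedFDeriv ℝ (m - i) g z‖
      ≤ (m.choose i : ℝ) * M₁ ^ i * M₂ ^ (m - i) := by
        refine mul_le_mul (mul_le_mul_of_nonneg_left (hfb i him) (Nat.cast_nonneg _)) (hgb (m - i) (Nat.sub_le m i))
          (norm_nonneg _) (mul_nonneg (Nat.cast_nonneg _) (pow_nonneg hM₁ _))
    _ = M₁ ^ i * M₂ ^ (m - i) * (m.choose i : ℝ) := by ring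

/-- A difference of two functions with values of norm `≤ 1` and rates `M^j` (`j ≥ 1`) has rates `(2 max(M,1))^j`; stated with
`1 ≤ M` for simplicity: rates `(2M)^j` for all `j ≤ m`. -/
theorem norm_iteratedFDeriv_sub_le_pow {f g : E → A} (hf : ContDiff ℝ ∞ f) (hg : ContDiff ℝ ∞ g) {M : ℝ} (hM : 1 ≤ M)
    (m : ℕ) (z : E) (hf0 : ‖f z - g z‖ ≤ 1)
    (hfb : ∀ j : ℕ, 1 ≤ j → j ≤ m → ‖iteratedFDeriv ℝ j f z‖ ≤ M ^ j)
    (hgb : ∀ j : ℕ, 1 ≤ j → j ≤ m → ‖iteratedFDeriv ℝ j g z‖ ≤ M ^ j) :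
    ∀ j : ℕ, j ≤ m → ‖iteratedFDeriv ℝ j (fun x => f x - g x) z‖ ≤ (2 * M) ^ j := by
  intro j hj
  rcases Nat.eq_zero_or_pos j with rfl | hjpos
  · rw [pow_zero, norm_iteratedFDeriv_zero]; exact hf0
  · have hsub : iteratedFDeriv ℝ j (fun x => f x - g x) z = iteratedFDeriv ℝ j f z - iteratedFDeriv ℝ j g z := by
      have := iteratedFDeriv_sub_apply (𝕜 := ℝ) (f := f) (g := g) (i := j) (x := z)
        (hf.contDiffAt.of_le (by exact_mod_cast le_top)) (hg.contDiffAt.of_le (by exact_mod_cast le_top))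
      exact this
    rw [hsub]
    calc ‖iteratedFDeriv ℝ j f z - iteratedFDeriv ℝ j g z‖ ≤ M ^ j + M ^ j :=
          (norm_sub_le _ _).trans (add_le_add (hfb j hjpos hj) (hgb j hjpos hj))
      _ = 2 * M ^ j := by ring
      _ ≤ (2 * M) ^ j := by
          rw [mul_pow]
          refine mul_le_mul_of_nonneg_right (le_self_pow₀ (by norm_num) (by omega)) (pow_nonneg (by linarith) _)

end Rates

/-! ## Telescoping assembly -/

section Assembly

variable {I : Type*}

/-- The telescoping coefficients: `t 0 = χ 0`, `t (k+1) = χ (k+1) − χ k`. -/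
def tele (χ : ℕ → ℝ) : ℕ → ℝ
  | 0 => χ 0
  | k + 1 => χ (k + 1) - χ k

/-- Partial sums of `tele χ` telescope to `χ`. -/
theorem sum_range_tele (χ : ℕ → ℝ) (K : ℕ) : ∑ k ∈ Finset.range (K + 1), tele χ k = χ K := by
  induction K with
  | zero => simp [tele]
  | succ K ih => rw [Finset.sum_range_succ, ih]; simp [tele]

/-- Beyond the stabilisation index the telescoping coefficients vanish. -/
theorem tele_eq_zero_of_stable (χ : ℕ → ℝ) {k₀ : ℕ} (hχ : ∀ K, k₀ ≤ K → χ K = 1) {k : ℕ} (hk : k₀ < k) :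
    tele χ k = 0 := by
  obtain ⟨j, rfl⟩ : ∃ j, k = j + 1 := ⟨k - 1, by omega⟩
  simp only [tele]
  rw [hχ (j + 1) (by omega), hχ j (by omega), sub_self]

/-- **Pointwise assembly of the telescoping partition.**  Let `χ K = 1` for `K ≥ k₀` (the cut-offs have stabilised at the point),
and for every level `k` let the family `c ↦ Φ k c` vanish off a finite `box k` and sum to `1` over it.  Then the double family
`(k, c) ↦ a · tele χ k · Φ k c` sums to `a`. [folklore] -/
theorem hasSum_telescope_mul_partition [DecidableEq I] (a : ℝ) (χ : ℕ → ℝ) {k₀ : ℕ} (hχ : ∀ K, k₀ ≤ K → χ K = 1)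
    (Φ : ℕ → I → ℝ) (box : ℕ → Finset I) (hoff : ∀ k c, c ∉ box k → Φ k c = 0)
    (hone : ∀ k, ∑ c ∈ box k, Φ k c = 1) :
    HasSum (fun p : ℕ × I => a * tele χ p.1 * Φ p.1 p.2) a := by
  classical
  -- the finite support
  let S : Finset (ℕ × I) := (Finset.range (k₀ + 1)).sigma (fun k => box k) |>.map
    ⟨fun s => (s.1, s.2), fun s t h => by cases s; cases t; simp_all⟩
  have hmemS : ∀ p : ℕ × I, p ∈ S ↔ p.1 < k₀ + 1 ∧ p.2 ∈ box p.1 := by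
    intro p
    constructor
    · intro hp
      rw [Finset.mem_map] at hp
      obtain ⟨s, hs, rfl⟩ := hp
      rw [Finset.mem_sigma, Finset.mem_range] at hs
      exact hs
    · rintro ⟨h1, h2⟩
      rw [Finset.mem_map]
      exact ⟨⟨p.1, p.2⟩, Finset.mem_sigma.2 ⟨Finset.mem_range.2 h1, h2⟩, rfl⟩
  have hzero : ∀ p : ℕ × I, p ∉ S → a * tele χ p.1 * Φ p.1 p.2 = 0 := by
    intro p hp
    rw [hmemS, not_and_or, not_lt] at hp
    rcases hp with hp | hp
    · rw [tele_eq_zero_of_stable χ hχ (by omega), mul_zero, zero_mul]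
    · rw [hoff _ _ hp, mul_zero]
  have hfin : HasSum (fun p : ℕ × I => a * tele χ p.1 * Φ p.1 p.2) (∑ p ∈ S, a * tele χ p.1 * Φ p.1 p.2) :=
    hasSum_sum_of_ne_finset_zero hzero
  have hval : ∑ p ∈ S, a * tele χ p.1 * Φ p.1 p.2 = a := by
    rw [Finset.sum_map, Finset.sum_sigma]
    simp only [Function.Embedding.coeFn_mk]
    calc ∑ k ∈ Finset.range (k₀ + 1), ∑ c ∈ box k, a * tele χ k * Φ k c
        = ∑ k ∈ Finset.range (k₀ + 1), a * tele χ k := by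
          refine Finset.sum_congr rfl fun k _ => ?_
          rw [← Finset.mul_sum, hone k, mul_one]
      _ = a * χ k₀ := by rw [← Finset.mul_sum, sum_range_tele]
      _ = a := by rw [hχ k₀ le_rfl, mul_one]
  rwa [hval] at hfin

/-- On the coincidence locus (`a = 0`) the same family trivially sums to `a`. -/
theorem hasSum_telescope_mul_partition_of_eq_zero (a : ℝ) (ha : a = 0) (χ : ℕ → ℝ) (Φ : ℕ → I → ℝ) :
    HasSum (fun p : ℕ × I => a * tele χ p.1 * Φ p.1 p.2) a := by
  subst ha
  have : (fun p : ℕ × I => (0 : ℝ) * tele χ p.1 * Φ p.1 p.2) = fun _ => 0 := by funext p; ring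
  rw [this]; exact hasSum_zero

end Assembly

end Summit.QuantumFields.YangMills.Cruxes.AtomicCalibrationR.TelescopingAssembly

end
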